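import Literature.NumberTheory.Sieve.SingularSeries
import Mathlib.Topology.Order.MonotoneConvergence
import Mathlib.Topology.Separation.Hausdorff
import HarnessLib

/-!
# Discharged facts: positivity of Vinogradov's ternary Goldbach singular series; the twin prime constant `C₂`

## 1. `ternaryGoldbachSingularSeries_pos`

`Literature.NumberTheory.Sieve.SingularSeries` records as a named fact
(`Literature.NumberTheory.Sieve.ternaryGoldbachSingularSeries_pos`) that Vinogradov's singular series
`𝔖₃(N) = ∏_p (1 + (p-1)⁻³) · ∏_{p ∣ N} (1 - (p² - 3p + 3)⁻¹)` (`Literature.NumberTheory.Sieve.ternaryGoldbachSingularSeries`,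
the infinite product taken as Mathlib's unconditional `∏'` over `Nat.Primes`) is positive for odd
`N`. It is proved here (`Literature.NumberTheory.Sieve.ternaryGoldbachSingularSeries_pos_holds`).

Source check. Vaughan, *The Hardy–Littlewood Method* (2nd ed., CUP 1997), §3.1: the singular
series of the three-primes problem is, by (3.13)–(3.15),
`𝔖(n) = ∏_{p ∤ n} (1 + (p-1)⁻³) ∏_{p ∣ n} (1 - (p-1)⁻²)`, followed by the remark (after
Theorem 3.3) that `𝔖(n)` is bounded below by an absolute positive constant when `n` is odd and
`𝔖(n) = 0` when `n` is even, which with Theorems 3.2 and 3.3 gives Theorem 3.4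
(`R(n) = ½ n² 𝔖(n) + O(n² (log n)^{-A})` for the log-weighted count `R(n)` of (3.5)) and its
Corollary (every sufficiently large odd `n` is a sum of three primes). The vendored shape is the same real number: for a prime `p`,
`(1 + (p-1)⁻³)(1 - (p² - 3p + 3)⁻¹) = p(p² - 3p + 3)/(p-1)³ · (p-1)(p-2)/(p² - 3p + 3) = 1 - (p-1)⁻²`,
so moving the factors `1 + (p-1)⁻³` at `p ∣ n` into the first product yields
`∏_p (1 + (p-1)⁻³) ∏_{p ∣ n} (1 - (p² - 3p + 3)⁻¹)` (the form printed e.g. in Vinogradov 1937 and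
Davenport, *Multiplicative Number Theory*, ch. 26). The fact `0 < 𝔖₃(N)` for odd `N` is the
(weaker, qualitative) content of Vaughan's remark; it is stated correctly and needs no correction.

Proof. Every factor of `∏_p (1 + (p-1)⁻³)` exceeds `1`; the product converges absolutely since
`(p-1)⁻³ ≤ 8 p⁻³` (`p ≥ 2`) and `∑_n n⁻³ < ∞` (`Real.summable_nat_pow_inv`, restricted to the primes by
`Summable.comp_injective`), so by `Real.rexp_tsum_eq_tprod` it equals
`exp (∑_p log (1 + (p-1)⁻³)) > 0`. For odd `N` every prime `p ∣ N` is odd, hence `p ≥ 3`,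
`p² - 3p + 3 ≥ 3` and `1 - (p² - 3p + 3)⁻¹ ≥ 2/3 > 0`; the finite product is positive by
`Finset.prod_pos`. (At `p = 2` the local factor `1 - (4 - 6 + 3)⁻¹` vanishes, matching
`𝔖(n) = 0` for even `n`.)

## 2. `tendsto_twinPrimeConstPartial` and `twinPrimeConst_pos`

`Literature.NumberTheory.Sieve.SingularSeries` defines the twin prime constant as an ordered limit,
`Literature.twinPrimeConst = limUnder atTop twinPrimeConstPartial` with
`twinPrimeConstPartial x = ∏_{2 < p ≤ x} (1 - 1/(p-1)²)`, and records as named facts (D-0014)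

* `Literature.NumberTheory.Sieve.tendsto_twinPrimeConstPartial` : the partial products converge to `C₂`;
* `Literature.NumberTheory.Sieve.twinPrimeConst_pos` : `0 < C₂`.

Both are discharged here (`…_holds`), exactly as the docstring of the first fact says
("decreasing, bounded below by a positive constant"):

* every factor `1 - 1/(p-1)²`, `p ≥ 3`, lies in `[0, 1]`, so `twinPrimeConstPartial` is antitone
  (`twinPrimeConstPartial_antitone`);
* comparing with the product over ALL integers `3 ≤ n ≤ x + 2`, which telescopes,
  `∏_{n=3}^{k+2} (1 - 1/(n-1)²) = (k+2)/(2(k+1))` (`prod_Icc_twinPrimeConstFactor`), gives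
  `1/2 ≤ twinPrimeConstPartial x` (`half_le_twinPrimeConstPartial`);
* an antitone sequence bounded below converges to its infimum (Mathlib `tendsto_atTop_ciInf`),
  `limUnder` of a convergent sequence is its limit (Mathlib `Filter.Tendsto.limUnder_eq`), hence
  `C₂ = ⨅ x, twinPrimeConstPartial x ≥ 1/2 > 0` (`half_le_twinPrimeConst`, `twinPrimeConst_le_one`).

These two facts are hypotheses of accepted conditional theorems
(`Literature.NumberTheory.Sieve.AletheiaZomleferFukshanskyGarcia2020Applications`:
`twinPrimeConjecture_of_batemanHorn`, `sophieGermain_infinite_of_batemanHorn`, …) and of the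
reduction of Chen's theorem `Literature.NumberTheory.Sieve.chen_goldbach` to its quantitative form (Chen 1973 /
Nathanson GTM 164 Thm 10.1), whose main term carries the factor `2 C₂ > 0`.

## References

* R. C. Vaughan, *The Hardy–Littlewood Method*, 2nd ed., Cambridge Tracts in Mathematics 125,
  CUP 1997, §3.1, (3.15), Theorems 3.3–3.4. [VaughanHL1997]
* I. M. Vinogradov, *Representation of an odd number as a sum of three primes*, Dokl. Akad. Nauk
  SSSR 15 (1937), 291–294.
* G. H. Hardy, J. E. Littlewood, *Some problems of 'Partitio numerorum'; III*, Acta Math. 44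
  (1923), 1–70, (5.311) (the constant `C₂`). [HardyLittlewood1923]
* H. Halberstam, H.-E. Richert, *Sieve Methods*, Academic Press 1974, Ch. 10 (convergence of
  singular series).
-/

noncomputable section

open Filter Finset
open scoped Topology

namespace Literature.NumberTheory.Sieve

/-- The tail terms of Vinogradov's product are summable over the primes:
`∑_p (p-1)⁻³ < ∞`, by comparison with `8 ∑_n n⁻³`. Vaughan, *The Hardy–Littlewood Method*,
§3.1 (absolute convergence of (3.13)/(3.15)). [cite: VaughanHL1997, Thm. 3.4] -/
theorem summable_primes_one_div_sub_one_pow_three :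
    Summable fun p : Nat.Primes ↦ 1 / (((p : ℕ) : ℝ) - 1) ^ 3 := by
  have h8 : Summable fun p : Nat.Primes ↦ 8 * ((((p : ℕ) : ℝ)) ^ 3)⁻¹ :=
    ((Real.summable_nat_pow_inv.mpr (by norm_num : 1 < 3)).mul_left 8).comp_injective
      Nat.Primes.coe_nat_injective
  refine Summable.of_nonneg_of_le (fun p ↦ ?_) (fun p ↦ ?_) h8
  · have hp2 : (2 : ℝ) ≤ ((p : ℕ) : ℝ) := by exact_mod_cast p.2.two_le
    have hq : 0 < ((p : ℕ) : ℝ) - 1 := by linarith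
    positivity
  · have hp2 : (2 : ℝ) ≤ ((p : ℕ) : ℝ) := by exact_mod_cast p.2.two_le
    have hq : 0 < ((p : ℕ) : ℝ) - 1 := by linarith
    have hp3 : 0 < ((p : ℕ) : ℝ) ^ 3 := by positivity
    rw [← one_div, mul_one_div, div_le_div_iff₀ (pow_pos hq 3) hp3, one_mul]
    have : ((p : ℕ) : ℝ) ≤ 2 * (((p : ℕ) : ℝ) - 1) := by linarith
    calc ((p : ℕ) : ℝ) ^ 3 ≤ (2 * (((p : ℕ) : ℝ) - 1)) ^ 3 := by gcongr
      _ = 8 * (((p : ℕ) : ℝ) - 1) ^ 3 := by ring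

/-- Every factor `1 + (p-1)⁻³` of Vinogradov's product is positive (indeed `> 1`).
[folklore] -/
theorem one_add_one_div_sub_one_pow_three_pos (p : Nat.Primes) :
    0 < 1 + 1 / (((p : ℕ) : ℝ) - 1) ^ 3 := by
  have hp2 : (2 : ℝ) ≤ ((p : ℕ) : ℝ) := by exact_mod_cast p.2.two_le
  have hq : 0 < ((p : ℕ) : ℝ) - 1 := by linarith
  positivity

/-- Vinogradov's product `∏_p (1 + (p-1)⁻³)` is multipliable (absolutely convergent), so the
unconditional `∏'` in `ternaryGoldbachSingularSeries` is a genuine value of the product.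
Vaughan, *The Hardy–Littlewood Method*, §3.1. [cite: VaughanHL1997, Thm. 3.4] -/
theorem multipliable_primes_one_add_one_div_sub_one_pow_three :
    Multipliable fun p : Nat.Primes ↦ 1 + 1 / (((p : ℕ) : ℝ) - 1) ^ 3 :=
  Real.multipliable_one_add_of_summable summable_primes_one_div_sub_one_pow_three

/-- The arithmetic-free part of `𝔖₃` is positive: `0 < ∏_p (1 + (p-1)⁻³)` (an absolutely
convergent product of factors `> 1`, equal to `exp ∑_p log (1 + (p-1)⁻³)`).
Vaughan, *The Hardy–Littlewood Method*, §3.1. [cite: VaughanHL1997, Thm. 3.4] -/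
theorem tprod_primes_one_add_one_div_sub_one_pow_three_pos :
    0 < ∏' p : Nat.Primes, (1 + 1 / (((p : ℕ) : ℝ) - 1) ^ 3) := by
  have hlog : Summable fun p : Nat.Primes ↦ Real.log (1 + 1 / (((p : ℕ) : ℝ) - 1) ^ 3) :=
    Real.summable_log_one_add_of_summable summable_primes_one_div_sub_one_pow_three
  rw [← Real.rexp_tsum_eq_tprod one_add_one_div_sub_one_pow_three_pos hlog]
  exact Real.exp_pos _

/-- For an odd prime `p` the local factor `1 - (p² - 3p + 3)⁻¹` of `𝔖₃` is positive, since
`p² - 3p + 3 ≥ 3`. (At `p = 2` it vanishes.) Vaughan, *The Hardy–Littlewood Method*, §3.1,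
remark after Theorem 3.3. [cite: VaughanHL1997, Thm. 3.4] -/
theorem ternaryGoldbach_localFactor_pos {p : ℕ} (hp : p.Prime) (hp2 : p ≠ 2) :
    0 < 1 - 1 / ((p : ℝ) ^ 2 - 3 * p + 3) := by
  have hp3 : 3 ≤ p := by
    have := hp.two_le
    omega
  have hp3' : (3 : ℝ) ≤ p := by exact_mod_cast hp3
  have hq : (3 : ℝ) ≤ (p : ℝ) ^ 2 - 3 * p + 3 := by nlinarith
  rw [sub_pos, div_lt_one (by linarith)]
  linarith

/-- Discharge of `ternaryGoldbachSingularSeries_pos`: `𝔖₃(N) > 0` for odd `N`. The infinite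
product `∏_p (1 + (p-1)⁻³)` is positive (`tprod_primes_one_add_one_div_sub_one_pow_three_pos`)
and, `N` being odd, every prime `p ∣ N` is odd, so every local factor `1 - (p² - 3p + 3)⁻¹` is
positive (`ternaryGoldbach_localFactor_pos`). Vaughan, *The Hardy–Littlewood Method*, 2nd ed.,
§3.1: (3.15), the remark after Theorem 3.3 (`𝔖(n)` is bounded below by a positive constant
for odd `n`, and vanishes for even `n`), and Theorem 3.4. [cite: VaughanHL1997, Thm. 3.4] -/
theorem ternaryGoldbachSingularSeries_pos_holds : ternaryGoldbachSingularSeries_pos := by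
  intro N hN
  unfold ternaryGoldbachSingularSeries
  refine mul_pos tprod_primes_one_add_one_div_sub_one_pow_three_pos (Finset.prod_pos ?_)
  intro p hp
  have hp' : p.Prime := Nat.prime_of_mem_primeFactors hp
  have hdvd : p ∣ N := Nat.dvd_of_mem_primeFactors hp
  have hp2 : p ≠ 2 := by
    rintro rfl
    exact hN.not_two_dvd_nat hdvd
  exact ternaryGoldbach_localFactor_pos hp' hp2

/-! ### 2. The twin prime constant `C₂`: the factors `1 - 1/(n-1)²` -/

/-- For `n ≥ 3` the factor `1 - 1/(n-1)²` is nonnegative. [folklore] -/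
theorem twinPrimeConstFactor_nonneg {n : ℕ} (hn : 3 ≤ n) : 0 ≤ 1 - 1 / ((n : ℝ) - 1) ^ 2 := by
  have h3 : (3 : ℝ) ≤ n := by exact_mod_cast hn
  have h : (4 : ℝ) ≤ ((n : ℝ) - 1) ^ 2 := by nlinarith
  rw [sub_nonneg, div_le_one (by positivity)]
  linarith

/-- Every factor `1 - 1/(n-1)²` is at most `1`. [folklore] -/
theorem twinPrimeConstFactor_le_one (n : ℕ) : 1 - 1 / ((n : ℝ) - 1) ^ 2 ≤ 1 := by
  have : 0 ≤ 1 / ((n : ℝ) - 1) ^ 2 := by positivity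
  linarith

/-- The telescoping product over all integers: `∏_{n=3}^{k+2} (1 - 1/(n-1)²) = (k+2)/(2(k+1))`
(`1 - 1/(n-1)² = (n-2)n/(n-1)²`). [folklore] -/
theorem prod_Icc_twinPrimeConstFactor (k : ℕ) :
    ∏ n ∈ Icc 3 (k + 2), (1 - 1 / ((n : ℝ) - 1) ^ 2) = ((k : ℝ) + 2) / (2 * ((k : ℝ) + 1)) := by
  induction k with
  | zero =>
    rw [Finset.Icc_eq_empty_of_lt (by norm_num), Finset.prod_empty]
    norm_num
  | succ k ih =>
    rw [show k + 1 + 2 = (k + 2) + 1 from rfl, Finset.prod_Icc_succ_top (by omega), ih]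
    have h1 : (k : ℝ) + 1 ≠ 0 := by positivity
    have h2 : (k : ℝ) + 2 ≠ 0 := by positivity
    have h3 : ((k + 2 + 1 : ℕ) : ℝ) - 1 = (k : ℝ) + 2 := by push_cast; ring
    rw [h3]
    push_cast
    field_simp
    ring

/-! ### Monotonicity and the uniform lower bound `1/2` -/

/-- `x ↦ ∏_{2 < p ≤ x} (1 - 1/(p-1)²)` is non-increasing (the factors lie in `[0, 1]`). [folklore] -/
theorem twinPrimeConstPartial_antitone : Antitone twinPrimeConstPartial := by
  intro x y hxy
  unfold twinPrimeConstPartial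
  apply Finset.prod_le_prod_of_subset_of_le_one
  · intro p hp
    simp only [Finset.mem_filter, Nat.mem_primesLE] at hp ⊢
    exact ⟨⟨hp.1.1.trans hxy, hp.1.2⟩, hp.2⟩
  · intro p hp
    simp only [Finset.mem_filter, Nat.mem_primesLE] at hp
    exact twinPrimeConstFactor_nonneg (by omega)
  · intro p _ _
    exact twinPrimeConstFactor_le_one p

/-- `1/2 ≤ ∏_{2 < p ≤ x} (1 - 1/(p-1)²)` for every `x`: the primes `2 < p ≤ x` form a subset of
the integers `3 ≤ n ≤ x + 2`, over which the product telescopes to `(x+2)/(2(x+1)) ≥ 1/2`.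
[folklore] -/
theorem half_le_twinPrimeConstPartial (x : ℕ) : 1 / 2 ≤ twinPrimeConstPartial x := by
  unfold twinPrimeConstPartial
  have hx : (0 : ℝ) < (x : ℝ) + 1 := by positivity
  calc (1 : ℝ) / 2 ≤ ((x : ℝ) + 2) / (2 * ((x : ℝ) + 1)) := by
        rw [div_le_div_iff₀ (by norm_num) (by positivity)]
        nlinarith
    _ = ∏ n ∈ Icc 3 (x + 2), (1 - 1 / ((n : ℝ) - 1) ^ 2) := (prod_Icc_twinPrimeConstFactor x).symm
    _ ≤ ∏ p ∈ (Nat.primesLE x).filter (2 < ·), (1 - 1 / ((p : ℝ) - 1) ^ 2) := by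
        apply Finset.prod_le_prod_of_subset_of_le_one
        · intro p hp
          simp only [Finset.mem_filter, Nat.mem_primesLE] at hp
          simp only [Finset.mem_Icc]
          omega
        · intro n hn
          simp only [Finset.mem_Icc] at hn
          exact twinPrimeConstFactor_nonneg hn.1
        · intro n _ _
          exact twinPrimeConstFactor_le_one n

/-! ### Convergence and positivity -/

/-- The partial products converge to their infimum (antitone and bounded below; Mathlib
`tendsto_atTop_ciInf`). [folklore] -/
theorem tendsto_twinPrimeConstPartial_ciInf :
    Tendsto twinPrimeConstPartial atTop (𝓝 (⨅ x, twinPrimeConstPartial x)) :=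
  tendsto_atTop_ciInf twinPrimeConstPartial_antitone
    ⟨1 / 2, by rintro _ ⟨x, rfl⟩; exact half_le_twinPrimeConstPartial x⟩

/-- `C₂ = ⨅ x, ∏_{2 < p ≤ x} (1 - 1/(p-1)²)` (the ordered limit of a convergent sequence is its
limit, Mathlib `Filter.Tendsto.limUnder_eq`). [folklore] -/
theorem twinPrimeConst_eq_ciInf : twinPrimeConst = ⨅ x, twinPrimeConstPartial x :=
  tendsto_twinPrimeConstPartial_ciInf.limUnder_eq

/-- **Discharge of `tendsto_twinPrimeConstPartial`**: the partial products
`∏_{2 < p ≤ x} (1 - 1/(p-1)²)` converge to `C₂` (Hardy–Littlewood 1923, (5.311); they are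
decreasing and bounded below). [cite: HardyLittlewood1923, (5.311)] -/
theorem tendsto_twinPrimeConstPartial_holds : tendsto_twinPrimeConstPartial := by
  show Tendsto twinPrimeConstPartial atTop (𝓝 twinPrimeConst)
  rw [twinPrimeConst_eq_ciInf]
  exact tendsto_twinPrimeConstPartial_ciInf

/-- `1/2 ≤ C₂` (crude but explicit; `C₂ = 0.6601…`). [folklore] -/
theorem half_le_twinPrimeConst : 1 / 2 ≤ twinPrimeConst := by
  rw [twinPrimeConst_eq_ciInf]
  exact le_ciInf half_le_twinPrimeConstPartial

/-- `C₂ ≤ 1` (every partial product is at most the empty one). [folklore] -/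
theorem twinPrimeConst_le_one : twinPrimeConst ≤ 1 := by
  rw [twinPrimeConst_eq_ciInf]
  refine (ciInf_le ⟨1 / 2, ?_⟩ 0).trans (le_of_eq ?_)
  · rintro _ ⟨x, rfl⟩
    exact half_le_twinPrimeConstPartial x
  · simp [twinPrimeConstPartial]

/-- **Discharge of `twinPrimeConst_pos`**: `0 < C₂` (Hardy–Littlewood 1923, (5.311)).
[cite: HardyLittlewood1923, (5.311)] -/
theorem twinPrimeConst_pos_holds : twinPrimeConst_pos := by
  show 0 < twinPrimeConst
  linarith [half_le_twinPrimeConst]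

end Literature.NumberTheory.Sieve
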